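import Mathlib
import Literature.RingTheory.CohomologyAnnihilator.Basic
import HarnessLib

/-!
# The cohomology annihilator of a commutative noetherian ring (Iyengar–Takahashi)

Topic: `Literature/RingTheory/CohomologyAnnihilator`. Vocabulary and named facts for route
`ResolutionOfSingularities/HomologicalConductor` (items `NoZeno` stmt-ResolutionOfSingularities-16483,
`Persistence` -16484, `StrictDrop` -16485, `Globalisation` -16486), whose route file inlines the
cohomology annihilator as a `let` over Mathlib's `CategoryTheory.Abelian.Ext` on `ModuleCat`; this
file names that ideal and vendors what is PRINTED about it.

* `caFrom R n` — the ideal `caⁿ(R) = ann_R Ext^{≥ n}_R(mod R, mod R)` of Iyengar–Takahashi,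
  Def. 2.1: the elements `a ∈ R` with `a · Ext^i_R(M, N) = 0` for all finitely generated `M, N`
  and all `i ≥ n` (for a COMMUTATIVE ring the centre is the ring itself).
* `ca R = ⋃ₙ caⁿ(R)` — the **cohomology annihilator** (Def. 2.1), an ideal since the `caⁿ`
  increase with `n` (`caFrom_mono`).
* `singSubsetVCa` — Lemma 2.10 (2): `Sing R ⊆ V(ca R)` for every commutative noetherian ring.
* `caLocalization` — Lemma 2.10 (1): `U⁻¹ caⁿ(R) ⊆ caⁿ(U⁻¹R)` and `U⁻¹ ca(R) ⊆ ca(U⁻¹R)`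
  (an INCLUSION only; no equality is printed).
* `singEqVCa_essFiniteType` — Theorem 5.4: for `R` a localisation of a finitely generated
  algebra of Krull dimension `d` over a field `k` (ANY field), `V(ca R) = V(ca^{2d+1} R) = Sing R`.

RECONCILIATION with the sibling vocabulary file `Basic.lean` (landed the same minute by the
definition seat): `caFrom R n = cohomologyAnnihilatorOfDegree R n` and `ca R = cohomologyAnnihilator R`
(`caFrom_eq_cohomologyAnnihilatorOfDegree`, `ca_eq_cohomologyAnnihilator`, both by membership
unfolding; the route's inline `let ca` is then `Subalgebra.image_coe_cohomologyAnnihilator` of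
`Basic.lean`), so the named facts below can be read over either name; `Basic.lean` is the API file
(monotonicity, noetherian stabilisation, `Subalgebra.image_coe_cohomologyAnnihilator` = the route's
inline `let ca`), this file carries the printed theorems.

`Sing R` is rendered as `{𝔭 | R_𝔭 is not a regular local ring}` (Iyengar–Takahashi, §2:
`Reg Λ = {𝔭 | gldim Λ_𝔭 < ∞}`, which for a commutative noetherian local ring is regularity by
Auslander–Buchsbaum–Serre), i.e. the complement of `Literature.AlgebraicGeometry.Resolution.regularLocus`
written out with Mathlib's `IsRegularLocalRing` so that this file imports Mathlib only.

Deliberately NOT here: Theorem 5.3 (equicharacteristic excellent local rings; needs the tree's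
excellence vocabulary), the strong-generation half of Thms 5.3/5.4 (`syz^d(mod R) ⊆ |G|ₙ`),
Esentepe's persistence `f(ca R) ⊆ ca S` under the weak MCM-extending property (arXiv:1807.05471,
Thm. 5.1: Gorenstein rings, MCM vocabulary not in the tree), Kimura's stability index
(arXiv:2409.17934). No equality `ca(U⁻¹R) = U⁻¹ca(R)` is claimed anywhere in print; the route's
"ca is a sheaf" step is its own business.

## References

* S. B. Iyengar, R. Takahashi, *Annihilation of cohomology and strong generation of module
  categories*, arXiv:1404.1476 (IMRN 2016): Def. 2.1, Lemma 2.10, Thm. 5.3, Thm. 5.4.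
  [`IyengarTakahashi2014`]
-/

noncomputable section

namespace Literature.RingTheory.CohomologyAnnihilator

open CategoryTheory CategoryTheory.Abelian

universe u

section Defs

variable (R : Type u) [CommRing R]

/-- The ideal `caⁿ(R) := ann_R Ext^{⩾ n}_R(mod R, mod R)` (Iyengar–Takahashi 2014, Def. 2.1:
"this ideal consists of elements `a ∈ Z(Λ)` such that `a Extⁱ_Λ(M,N) = 0` for all `M, N` in
`mod Λ` and integers `i ≥ n`"), for a commutative ring `R` (its own centre), with `mod R` the
finitely generated modules (`Module.Finite`) and `Ext` Mathlib's `CategoryTheory.Abelian.Ext` in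
`ModuleCat.{u} R`. [cite: IyengarTakahashi2014, Def. 2.1] -/
def caFrom (n : ℕ) : Ideal R where
  carrier := {a : R | ∀ i : ℕ, n ≤ i → ∀ (M N : ModuleCat.{u} R), Module.Finite R M →
    Module.Finite R N → ∀ e : Abelian.Ext.{u} M N i, a • e = 0}
  zero_mem' := by
    intro i _ M N _ _ e
    exact zero_smul R e
  add_mem' := by
    intro a b ha hb i hi M N hM hN e
    rw [add_smul, ha i hi M N hM hN e, hb i hi M N hM hN e, add_zero]
  smul_mem' := by
    intro c a ha i hi M N hM hN e
    rw [smul_eq_mul, mul_smul, ha i hi M N hM hN e, smul_zero]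

/-- Membership in `caⁿ(R)`, unfolded. [cite: IyengarTakahashi2014, Def. 2.1] -/
theorem mem_caFrom_iff {n : ℕ} {a : R} :
    a ∈ caFrom R n ↔ ∀ i : ℕ, n ≤ i → ∀ (M N : ModuleCat.{u} R), Module.Finite R M →
      Module.Finite R N → ∀ e : Abelian.Ext.{u} M N i, a • e = 0 :=
  Iff.rfl

/-- `caⁿ(R) ⊆ caⁿ⁺¹(R)`, and more generally the `caⁿ` increase with `n` ("Note that
`caⁿ(Λ) ⊆ caⁿ⁺¹(Λ)`", Iyengar–Takahashi 2014, after Def. 2.1). [cite: IyengarTakahashi2014, Def. 2.1] -/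
theorem caFrom_mono {m n : ℕ} (h : m ≤ n) : caFrom R m ≤ caFrom R n :=
  fun _ ha i hi => ha i (h.trans hi)

/-- The **cohomology annihilator** `ca(R) := ⋃_{n ≥ 0} caⁿ(R)` of a commutative ring
(Iyengar–Takahashi 2014, Def. 2.1: "The cohomology annihilator of `Λ` is the union of these
ideals"); an ideal because the union is increasing (`caFrom_mono`). For `R` noetherian it equals
`caˢ(R)` for some `s` (loc. cit.), not recorded here. [cite: IyengarTakahashi2014, Def. 2.1] -/
def ca : Ideal R where
  carrier := {a : R | ∃ n : ℕ, a ∈ caFrom R n}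
  zero_mem' := ⟨0, (caFrom R 0).zero_mem⟩
  add_mem' := by
    rintro a b ⟨m, ha⟩ ⟨n, hb⟩
    exact ⟨max m n, (caFrom R (max m n)).add_mem (caFrom_mono R (le_max_left m n) ha)
      (caFrom_mono R (le_max_right m n) hb)⟩
  smul_mem' := by
    rintro c a ⟨n, ha⟩
    exact ⟨n, (caFrom R n).smul_mem c ha⟩

/-- Membership in `ca(R)`, unfolded: `a ∈ ca(R) ↔ ∃ n, ∀ i ≥ n, ∀ M N ∈ mod R, a · Extⁱ(M,N) = 0`
— literally the inline `let ca` of route `ResolutionOfSingularities/HomologicalConductor` (with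
`u = 0`). [cite: IyengarTakahashi2014, Def. 2.1] -/
theorem mem_ca_iff {a : R} :
    a ∈ ca R ↔ ∃ n : ℕ, ∀ i : ℕ, n ≤ i → ∀ (M N : ModuleCat.{u} R), Module.Finite R M →
      Module.Finite R N → ∀ e : Abelian.Ext.{u} M N i, a • e = 0 :=
  Iff.rfl

/-- `caⁿ(R) ⊆ ca(R)`. [cite: IyengarTakahashi2014, Def. 2.1] -/
theorem caFrom_le_ca (n : ℕ) : caFrom R n ≤ ca R := fun _ ha => ⟨n, ha⟩

/-- The two vocabularies of this directory agree degreewise: `caFrom R n` is the ideal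
`cohomologyAnnihilatorOfDegree R n` of `Basic.lean` (same membership predicate).
[cite: IyengarTakahashi2014, Def. 2.1] -/
theorem caFrom_eq_cohomologyAnnihilatorOfDegree (n : ℕ) :
    caFrom R n = cohomologyAnnihilatorOfDegree R n :=
  le_antisymm (fun _ ha => mem_cohomologyAnnihilatorOfDegree_iff.mpr ha)
    (fun _ ha => mem_cohomologyAnnihilatorOfDegree_iff.mp ha)

/-- The two vocabularies of this directory agree: `ca R` is the ideal `cohomologyAnnihilator R` of
`Basic.lean`; in particular, after `rw [ca_eq_cohomologyAnnihilator]`, the landed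
`Subalgebra.image_coe_cohomologyAnnihilator` identifies the image of `ca A` in `K` (for a subalgebra
`A ⊆ K`) with the inline `let ca` of route `ResolutionOfSingularities/HomologicalConductor`.
[cite: IyengarTakahashi2014, Def. 2.1] -/
theorem ca_eq_cohomologyAnnihilator : ca R = cohomologyAnnihilator R :=
  le_antisymm (fun _ ha => mem_cohomologyAnnihilator_iff'.mpr ha)
    (fun _ ha => mem_cohomologyAnnihilator_iff'.mp ha)

end Defs

/-! ## Named facts -/

/-- NAMED FACT — **Iyengar–Takahashi 2014, Lemma 2.10 (2)**: "There is an inclusion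
`Sing Λ ⊆ V(ca Λ)`", for `Λ` a noether algebra (here: a commutative noetherian ring `R`), where
`Sing Λ = {𝔭 | gldim Λ_𝔭 = ∞}` — for commutative noetherian `R`, the primes at which `R_𝔭` is not a
regular local ring (Auslander–Buchsbaum–Serre). Rendered: if `R_𝔭` is not regular then
`ca(R) ⊆ 𝔭`. Users take `(h : singSubsetVCa)`. [cite: IyengarTakahashi2014, Lemma 2.10 (2)] -/
def singSubsetVCa : Prop :=
  ∀ (R : Type u) [CommRing R], IsNoetherianRing R → ∀ (𝔭 : Ideal R) [𝔭.IsPrime],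
    ¬ IsRegularLocalRing (Localization.AtPrime 𝔭) → ca R ≤ 𝔭

/-- NAMED FACT — **Iyengar–Takahashi 2014, Lemma 2.10 (1)**: "For any multiplicatively closed
subset `U ⊂ Z(Λ)` there are inclusions `U⁻¹ caⁿ(Λ) ⊆ caⁿ(U⁻¹Λ)` and `U⁻¹ ca(Λ) ⊆ ca(U⁻¹Λ)`", for
`Λ` a noether algebra (here a commutative noetherian ring `R`, `R' = U⁻¹R` any localisation,
`IsLocalization U R'`). Only these INCLUSIONS are printed (the extension of the ideal along
`R → U⁻¹R` lies in the annihilator ideal of the localisation); no equality. Users take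
`(h : caLocalization)`. [cite: IyengarTakahashi2014, Lemma 2.10 (1)] -/
def caLocalization : Prop :=
  ∀ (R : Type u) [CommRing R], IsNoetherianRing R → ∀ (U : Submonoid R) (R' : Type u) [CommRing R']
    [Algebra R R'], IsLocalization U R' →
      (∀ n : ℕ, (caFrom R n).map (algebraMap R R') ≤ caFrom R' n) ∧
        (ca R).map (algebraMap R R') ≤ ca R'

/-- NAMED FACT — **Iyengar–Takahashi 2014, Theorem 5.4** (rings essentially of finite type over a
field; grounds `Summit.ResolutionOfSingularities.ResolutionOfSingularities.Theses.HomologicalConductor.Globalisation`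
and the stopping criterion of `….NoZeno`): "Let `k` be a field and `R` a localization of a
finitely generated `k`-algebra of Krull dimension `d`. There are equalities
`V(ca R) = V(ca^{2d+1} R) = Sing R`." (Proof: `R = U⁻¹A`, `A` finitely generated of Krull
dimension `d`; ANY field `k` — the imperfect case by base change to `k̄`, adapting
Keller–Van den Bergh.) Rendered prime by prime, with `d = dim A` for the finitely generated
algebra `A` that is localised (the reading of the proof) and `Sing R = {𝔭 | R_𝔭 not regular}`:
for every prime `𝔭` of `R`, `ca(R) ⊆ 𝔭 ↔ R_𝔭 is not regular ↔ ca^{2d+1}(R) ⊆ 𝔭`. The strong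
generator `syz^d(mod R) ⊆ |G|ₙ` of the same theorem is not recorded. Users take
`(h : singEqVCa_essFiniteType)`. [cite: IyengarTakahashi2014, Thm. 5.4] -/
def singEqVCa_essFiniteType : Prop :=
  ∀ (k : Type u) [Field k] (A : Type u) [CommRing A] [Algebra k A], Algebra.FiniteType k A →
    ∀ (d : ℕ), ringKrullDim A = d →
    ∀ (U : Submonoid A) (R : Type u) [CommRing R] [Algebra A R], IsLocalization U R →
      ∀ (𝔭 : Ideal R) [𝔭.IsPrime],
        (ca R ≤ 𝔭 ↔ ¬ IsRegularLocalRing (Localization.AtPrime 𝔭)) ∧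
          (caFrom R (2 * d + 1) ≤ 𝔭 ↔ ¬ IsRegularLocalRing (Localization.AtPrime 𝔭))

/-- Sanity consequence, PROVED: under Theorem 5.4, a localisation `R` of a finitely generated
algebra over a field that is itself a regular local ring has `ca(R) = R` (take `𝔭 = 𝔪_R`:
`R_𝔪 ≅ R` is regular, so `ca(R) ⊄ 𝔪`, i.e. `ca(R)` contains a unit) — the "regular ⇒ the
canonical tower is stationary" check of the route. Stated as the contrapositive membership form:
if `ca R ≤ 𝔭` for a prime `𝔭` then `R_𝔭` is singular. [cite: IyengarTakahashi2014, Thm. 5.4] -/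
theorem not_isRegularLocalRing_of_ca_le (h : singEqVCa_essFiniteType.{u}) {k : Type u} [Field k]
    {A : Type u} [CommRing A] [Algebra k A] (hA : Algebra.FiniteType k A) {d : ℕ}
    (hd : ringKrullDim A = d) (U : Submonoid A) (R : Type u) [CommRing R] [Algebra A R]
    (hR : IsLocalization U R) (𝔭 : Ideal R) [𝔭.IsPrime] (hp : ca R ≤ 𝔭) :
    ¬ IsRegularLocalRing (Localization.AtPrime 𝔭) :=
  ((h k A hA d hd U R hR 𝔭).1).mp hp

end Literature.RingTheory.CohomologyAnnihilator

end
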